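import Mathlib

/-!
# Crux `TateFamilyKernel` (stmt-KontsevichZagierPeriods-9130), line `Sketch` — stub `stub_linResidues`

Step 3 (LOG-ELIMINATION / RESIDUES) of the linear class of the lead's skeleton of the crux
`Summit.KontsevichZagierPeriods.KontsevichZagierPeriods.Theses.InverseLandau.TateFamilyKernel`:
`Q = 1 − ϖ(α + βz₂)z₁` (`0 < α`, `0 < β`), `ϖ`-free `P ∈ ℚ[z₁, z₂]`, `w(s) = α + βs`,
`Ψ(y,s) = P(y/w(s), s)/w(s)`. If `∫_{(y−α)/β}^1 Ψ(y,s) ds = 0` on `(α, α+β)` (conclusion of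
`stub_linDensity`), then `Ψ(y,·)` has a rational `s`-primitive `M(y,s)/w(s)^k`, `M ∈ ℚ[y,s]`,
valid for all real `y` and all `s` with `w(s) ≠ 0` (hypothesis of `stub_linExact`).

* `LinResidues.eq_zero_of_mul_log_eq` — **`log` is not rational on an interval**: if
  `g(u) log u = f(u)` on `(a,b) ⊂ (0,∞)` for real polynomials `f, g`, then `g = 0`; induction on
  the support of `g` with the Euler operator `θ = u d/du` (`(θg − m g) log = θf − g − m f`, and
  `θ − m` kills exactly the monomial `u^m`; at the end `θf − m f − g` vanishes on `(a,b)` while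
  its `u^m`-coefficient is `−g_m`).
* monomial calculus in `w`: `s^j = Σ_k β λ_{j,k} w^k`, `λ_{j,k} = C(j,k)(−α)^{j−k}/β^{j+1}`, so
  `s^j/w^{a+1} = Σ_{k ≠ a} β λ_{j,k} w^{k−a−1} + β λ_{j,a} w⁻¹` with the rational primitive
  `Σ_{k ≠ a} λ_{j,k}/(k−a) · w^{k−a}` of the first part (`hasDerivAt_monoPrim`); summed over
  `supp P` with weights `P_{a,j} y^a` the defect is `β Res(y)/w`, `Res(y) = Σ P_{a,j} λ_{j,a} y^a`
  (`hasDerivAt_primSum`).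
* `res_mul_log_eq`: the hypothesis at `y ∈ (α, α+β)`, by the fundamental theorem of calculus on
  `[(y−α)/β, 1]` (`w((y−α)/β) = y`), reads `Res(y) log y = (real polynomial in y)`; hence
  `Res ≡ 0` (`residue_eq_zero`), and clearing denominators (`k = max a`) in the primitive gives
  `M = Σ_{(a,j)} Σ_{k' ≠ a} P_{a,j} λ_{j,k'}/(k'−a) · X₀^a (α + βX₁)^{k−a+k'}` (`stub_linResidues`).

Mathlib only; no named fact, no new definition (all data are explicit finite sums over `P.support`).
-/

noncomputable section

open MeasureTheory Set MvPolynomial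
open scoped Topology

namespace Summit.KontsevichZagierPeriods.InverseLandau.TateFamilyKernel.Descent

namespace LinResidues

/-- Coefficients of the Euler operator `θ p = X · p′`: `(θ p)_n = n · p_n`. [folklore] -/
theorem coeff_X_mul_derivative (p : Polynomial ℝ) (n : ℕ) :
    (Polynomial.X * Polynomial.derivative p).coeff n = (n : ℝ) * p.coeff n := by
  cases n with
  | zero => simp
  | succ n => rw [Polynomial.coeff_X_mul, Polynomial.coeff_derivative]; push_cast; ring

/-- One `θ`-step: if `g log = f` on an open interval `(a,b) ⊂ (0,∞)`, then `(θ g) log = θ f − g`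
there (differentiate, multiply by `u`). [folklore] -/
theorem log_step {a b : ℝ} (ha : 0 < a) {f g : Polynomial ℝ}
    (h : ∀ u ∈ Ioo a b, g.eval u * Real.log u = f.eval u) (u : ℝ) (hu : u ∈ Ioo a b) :
    (Polynomial.X * Polynomial.derivative g).eval u * Real.log u =
      (Polynomial.X * Polynomial.derivative f - g).eval u := by
  have hu0 : 0 < u := ha.trans hu.1
  have hg : HasDerivAt (fun v => g.eval v * Real.log v)
      ((Polynomial.derivative g).eval u * Real.log u + g.eval u * u⁻¹) u :=
    (g.hasDerivAt u).mul (Real.hasDerivAt_log hu0.ne')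
  have heq : (fun v => f.eval v) =ᶠ[𝓝 u] fun v => g.eval v * Real.log v := by
    filter_upwards [Ioo_mem_nhds hu.1 hu.2] with v hv using (h v hv).symm
  have hd := (hg.congr_of_eventuallyEq heq).unique (f.hasDerivAt u)
  simp only [Polynomial.eval_mul, Polynomial.eval_X, Polynomial.eval_sub]
  calc u * (Polynomial.derivative g).eval u * Real.log u
        = u * ((Polynomial.derivative g).eval u * Real.log u + g.eval u * u⁻¹) - g.eval u := by
          field_simp; ring
    _ = u * (Polynomial.derivative f).eval u - g.eval u := by rw [hd]

/-- **`log` is not rational on an interval**: if `g(u) log u = f(u)` on `(a,b)`, `0 < a < b`, for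
real polynomials `f, g` (`g` with at most `n` monomials), then `g = 0`. Induction on the support:
for `m ∈ supp g`, `θ g − m g` has smaller support and satisfies such an identity (`log_step`), so it
vanishes; then `θ f − m f − g = 0` on `(a,b)`, hence as a polynomial, with `m`-th coefficient
`−g_m ≠ 0`. [folklore] -/
theorem eq_zero_of_mul_log_eq {a b : ℝ} (ha : 0 < a) (hab : a < b) (n : ℕ) :
    ∀ (f g : Polynomial ℝ), g.support.card ≤ n →
      (∀ u ∈ Ioo a b, g.eval u * Real.log u = f.eval u) → g = 0 := by
  induction n with
  | zero =>
    intro f g hcard _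
    exact Polynomial.support_eq_empty.mp (Finset.card_eq_zero.mp (Nat.le_zero.mp hcard))
  | succ n ih =>
    intro f g hcard h
    by_contra hg0
    obtain ⟨m, hm⟩ := Polynomial.support_nonempty.mpr hg0
    set g₂ : Polynomial ℝ :=
      Polynomial.X * Polynomial.derivative g - Polynomial.C (m : ℝ) * g with hg₂
    set f₂ : Polynomial ℝ :=
      Polynomial.X * Polynomial.derivative f - g - Polynomial.C (m : ℝ) * f with hf₂
    have h₂ : ∀ u ∈ Ioo a b, g₂.eval u * Real.log u = f₂.eval u := by
      intro u hu
      have h1 := log_step ha h u hu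
      have h0 := h u hu
      simp only [hg₂, hf₂, Polynomial.eval_sub, Polynomial.eval_mul, Polynomial.eval_C] at h1 ⊢
      linear_combination h1 - (m : ℝ) * h0
    have hsupp : g₂.support ⊆ g.support.erase m := by
      intro j hj
      have hcoeff : g₂.coeff j = ((j : ℝ) - m) * g.coeff j := by
        simp only [hg₂, Polynomial.coeff_sub, coeff_X_mul_derivative, Polynomial.coeff_C_mul]
        ring
      rw [Polynomial.mem_support_iff, hcoeff] at hj
      rw [Finset.mem_erase, Polynomial.mem_support_iff]
      refine ⟨?_, fun h0 => hj (by rw [h0, mul_zero])⟩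
      rintro rfl
      exact hj (by rw [sub_self, zero_mul])
    have hcard₂ : g₂.support.card ≤ n := by
      have h1 := Finset.card_le_card hsupp
      rw [Finset.card_erase_of_mem hm] at h1
      omega
    have hg₂0 : g₂ = 0 := ih f₂ g₂ hcard₂ h₂
    have hf₂0 : f₂ = 0 := by
      refine Polynomial.eq_zero_of_infinite_isRoot _ ((Set.Ioo_infinite hab).mono fun u hu => ?_)
      have h1 := h₂ u hu
      rw [hg₂0, Polynomial.eval_zero, zero_mul] at h1
      exact h1.symm
    have hcm : f₂.coeff m = 0 := by rw [hf₂0, Polynomial.coeff_zero]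
    simp only [hf₂, Polynomial.coeff_sub, coeff_X_mul_derivative, Polynomial.coeff_C_mul] at hcm
    exact (Polynomial.mem_support_iff.mp hm) (by linarith)

/-- `Ψ(y,s) = P(y/w, s)/w = Σ_{(a,j)} P_{a,j} y^a s^j / w^{a+1}` (`w = α + βs ≠ 0`). [folklore] -/
theorem aeval_div_eq_sum (α β : ℚ) (P : MvPolynomial (Fin 2) ℚ) (y s : ℝ)
    (hw : (α : ℝ) + β * s ≠ 0) :
    aeval ![y / ((α : ℝ) + β * s), s] P / ((α : ℝ) + β * s) =
      ∑ m ∈ P.support, ((P.coeff m : ℚ) : ℝ) *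
        (y ^ (m 0) * s ^ (m 1) / ((α : ℝ) + β * s) ^ (m 0 + 1)) := by
  rw [MvPolynomial.aeval_def, MvPolynomial.eval₂_eq', Finset.sum_div]
  refine Finset.sum_congr rfl fun m _ => ?_
  simp only [Fin.prod_univ_two, eq_ratCast, Matrix.cons_val_zero, Matrix.cons_val_one]
  rw [div_pow, pow_succ]
  field_simp

/-- Partial fractions of a monomial at the pole `w = 0` (`w = α + βs ≠ 0`, `β ≠ 0`):
`s^j/w^{a+1} = Σ_{k ≤ j, k ≠ a} β λ_{j,k} w^{k−a−1} + β λ_{j,a} w⁻¹`, `λ_{j,k} = C(j,k)(−α)^{j−k}/β^{j+1}`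
(binomial expansion of `s^j = ((w − α)/β)^j`; for `a > j`, `λ_{j,a} = 0`). [folklore] -/
theorem pow_div_eq_sum_add (α β : ℚ) (hβ : β ≠ 0) (a j : ℕ) (s : ℝ)
    (hw : (α : ℝ) + β * s ≠ 0) :
    s ^ j / ((α : ℝ) + β * s) ^ (a + 1) =
      (∑ k ∈ (Finset.range (j + 1)).erase a,
        (β : ℝ) * ((j.choose k : ℝ) * (-(α : ℝ)) ^ (j - k) / (β : ℝ) ^ (j + 1)) *
          ((α : ℝ) + β * s) ^ ((k : ℤ) - a - 1)) +
      (β : ℝ) * ((j.choose a : ℝ) * (-(α : ℝ)) ^ (j - a) / (β : ℝ) ^ (j + 1)) *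
        ((α : ℝ) + β * s)⁻¹ := by
  have hβ' : (β : ℝ) ≠ 0 := by exact_mod_cast hβ
  -- binomial expansion in `w`
  have key : ((β : ℝ) * s) ^ j = ∑ k ∈ Finset.range (j + 1),
      ((α : ℝ) + β * s) ^ k * (-(α : ℝ)) ^ (j - k) * (j.choose k : ℝ) := by
    rw [← add_pow]; ring
  have hs : s ^ j = ((β : ℝ) ^ j)⁻¹ * ((β : ℝ) * s) ^ j := by
    rw [mul_pow, ← mul_assoc, inv_mul_cancel₀ (pow_ne_zero _ hβ'), one_mul]
  have hall : s ^ j / ((α : ℝ) + β * s) ^ (a + 1) = ∑ k ∈ Finset.range (j + 1),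
      (β : ℝ) * ((j.choose k : ℝ) * (-(α : ℝ)) ^ (j - k) / (β : ℝ) ^ (j + 1)) *
        ((α : ℝ) + β * s) ^ ((k : ℤ) - a - 1) := by
    rw [hs, key, Finset.mul_sum, Finset.sum_div]
    refine Finset.sum_congr rfl fun k _ => ?_
    rw [zpow_sub₀ hw, zpow_sub₀ hw, zpow_natCast, zpow_natCast, zpow_one, pow_succ, pow_succ]
    field_simp
  rw [hall]
  by_cases ha : a ∈ Finset.range (j + 1)
  · rw [Finset.sum_erase_eq_sub ha]
    have h1 : ((a : ℤ) - a - 1) = -1 := by ring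
    rw [h1, zpow_neg_one]
    ring
  · have hja : j < a := by rw [Finset.mem_range] at ha; omega
    rw [Finset.erase_eq_of_notMem ha, Nat.choose_eq_zero_of_lt hja]
    simp

/-- Rational primitive of the non-residual part of `c · s^j/w^{a+1}`: at every `s` with `w(s) ≠ 0`,
`d/ds Σ_{k ≠ a} c λ_{j,k}/(k−a) · w^{k−a} = c (s^j/w^{a+1} − β λ_{j,a} w⁻¹)`. [folklore] -/
theorem hasDerivAt_monoPrim (α β : ℚ) (hβ : β ≠ 0) (a j : ℕ) (c s : ℝ)
    (hw : (α : ℝ) + β * s ≠ 0) :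
    HasDerivAt (fun s' : ℝ => ∑ k ∈ (Finset.range (j + 1)).erase a,
        c * (((j.choose k : ℝ) * (-(α : ℝ)) ^ (j - k) / (β : ℝ) ^ (j + 1)) / ((k : ℝ) - a)) *
          ((α : ℝ) + β * s') ^ ((k : ℤ) - a))
      (c * (s ^ j / ((α : ℝ) + β * s) ^ (a + 1) -
        (β : ℝ) * ((j.choose a : ℝ) * (-(α : ℝ)) ^ (j - a) / (β : ℝ) ^ (j + 1)) *
          ((α : ℝ) + β * s)⁻¹)) s := by
  have hlin : HasDerivAt (fun s' : ℝ => (α : ℝ) + β * s') (β : ℝ) s := by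
    simpa using ((hasDerivAt_id s).const_mul (β : ℝ)).const_add (α : ℝ)
  have hterm : ∀ k ∈ (Finset.range (j + 1)).erase a,
      HasDerivAt (fun s' : ℝ =>
          c * (((j.choose k : ℝ) * (-(α : ℝ)) ^ (j - k) / (β : ℝ) ^ (j + 1)) / ((k : ℝ) - a)) *
            ((α : ℝ) + β * s') ^ ((k : ℤ) - a))
        (c * (((j.choose k : ℝ) * (-(α : ℝ)) ^ (j - k) / (β : ℝ) ^ (j + 1)) / ((k : ℝ) - a)) *
          ((((k : ℤ) - a : ℤ) : ℝ) * ((α : ℝ) + β * s) ^ ((k : ℤ) - a - 1) * β)) s :=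
    fun k _ => ((hasDerivAt_zpow ((k : ℤ) - a) _ (Or.inl hw)).comp s hlin).const_mul _
  refine (HasDerivAt.fun_sum hterm).congr_deriv ?_
  rw [pow_div_eq_sum_add α β hβ a j s hw, add_sub_cancel_right, Finset.mul_sum]
  refine Finset.sum_congr rfl fun k hk => ?_
  have hka : (k : ℝ) - a ≠ 0 := sub_ne_zero.mpr (Nat.cast_injective.ne (Finset.ne_of_mem_erase hk))
  push_cast
  field_simp

/-- Summing `hasDerivAt_monoPrim` over `supp P` with weights `P_{a,j} y^a`: the explicit rational
function `Σ_{(a,j)} Σ_{k ≠ a} P_{a,j} y^a λ_{j,k}/(k−a) · w^{k−a}` has `s`-derivative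
`Ψ(y,s) − β Res(y)/w(s)`, `Res(y) = Σ_{(a,j)} P_{a,j} λ_{j,a} y^a`, wherever `w(s) ≠ 0`. [folklore] -/
theorem hasDerivAt_primSum (α β : ℚ) (hβ : β ≠ 0) (P : MvPolynomial (Fin 2) ℚ) (y s : ℝ)
    (hw : (α : ℝ) + β * s ≠ 0) :
    HasDerivAt (fun s' : ℝ => ∑ m ∈ P.support, ∑ k ∈ (Finset.range (m 1 + 1)).erase (m 0),
        ((P.coeff m : ℚ) : ℝ) * y ^ (m 0) *
          ((((m 1).choose k : ℝ) * (-(α : ℝ)) ^ (m 1 - k) / (β : ℝ) ^ (m 1 + 1)) /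
            ((k : ℝ) - m 0)) * ((α : ℝ) + β * s') ^ ((k : ℤ) - m 0))
      ((∑ m ∈ P.support, ((P.coeff m : ℚ) : ℝ) *
          (y ^ (m 0) * s ^ (m 1) / ((α : ℝ) + β * s) ^ (m 0 + 1))) -
        (β : ℝ) * (∑ m ∈ P.support, ((P.coeff m : ℚ) : ℝ) *
          (((m 1).choose (m 0) : ℝ) * (-(α : ℝ)) ^ (m 1 - m 0) / (β : ℝ) ^ (m 1 + 1)) *
            y ^ (m 0)) * ((α : ℝ) + β * s)⁻¹) s := by
  refine (HasDerivAt.fun_sum fun m _ =>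
    hasDerivAt_monoPrim α β hβ (m 0) (m 1) (((P.coeff m : ℚ) : ℝ) * y ^ (m 0)) s hw).congr_deriv ?_
  rw [Finset.mul_sum, Finset.sum_mul, ← Finset.sum_sub_distrib]
  refine Finset.sum_congr rfl fun m _ => ?_
  ring

/-- **The hypothesis, integrated.** For `y ∈ (α, α+β)` and `ζ = (y−α)/β ∈ (0,1)` (`w(ζ) = y`,
`w > 0` on `[ζ,1]`), `Ψ(y,·)` has the primitive `(rational part) + Res(y) log w` on `[ζ, 1]`, and
`∫_ζ^1 Ψ(y,s) ds = 0` becomes `Res(y) log y = (rational part)(1) − (rational part)(ζ) + Res(y) log(α+β)`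
(fundamental theorem of calculus). [folklore] -/
theorem res_mul_log_eq (α β : ℚ) (P : MvPolynomial (Fin 2) ℚ) (hα : 0 < α) (hβ : 0 < β)
    (hΦ : ∀ y ∈ Ioo (α : ℝ) (α + β), ∫ s in Ioo ((y - α) / β) 1,
      aeval ![y / ((α : ℝ) + β * s), s] P / ((α : ℝ) + β * s) = 0)
    (y : ℝ) (hy : y ∈ Ioo (α : ℝ) (α + β)) :
    (∑ m ∈ P.support, ((P.coeff m : ℚ) : ℝ) *
        (((m 1).choose (m 0) : ℝ) * (-(α : ℝ)) ^ (m 1 - m 0) / (β : ℝ) ^ (m 1 + 1)) *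
          y ^ (m 0)) * Real.log y =
      (∑ m ∈ P.support, ∑ k ∈ (Finset.range (m 1 + 1)).erase (m 0),
        ((P.coeff m : ℚ) : ℝ) * y ^ (m 0) *
          ((((m 1).choose k : ℝ) * (-(α : ℝ)) ^ (m 1 - k) / (β : ℝ) ^ (m 1 + 1)) /
            ((k : ℝ) - m 0)) * ((α : ℝ) + β) ^ ((k : ℤ) - m 0)) -
      (∑ m ∈ P.support, ∑ k ∈ (Finset.range (m 1 + 1)).erase (m 0),
        ((P.coeff m : ℚ) : ℝ) * y ^ (m 0) *
          ((((m 1).choose k : ℝ) * (-(α : ℝ)) ^ (m 1 - k) / (β : ℝ) ^ (m 1 + 1)) /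
            ((k : ℝ) - m 0)) * ((α : ℝ) + β * ((y - α) / β)) ^ ((k : ℤ) - m 0)) +
      (∑ m ∈ P.support, ((P.coeff m : ℚ) : ℝ) *
        (((m 1).choose (m 0) : ℝ) * (-(α : ℝ)) ^ (m 1 - m 0) / (β : ℝ) ^ (m 1 + 1)) *
          y ^ (m 0)) * Real.log ((α : ℝ) + β) := by
  set ζ : ℝ := (y - α) / β with hζ
  have hβ0 : (0 : ℝ) < β := by exact_mod_cast hβ
  have hα0 : (0 : ℝ) < α := by exact_mod_cast hα
  have hy0 : 0 < y := hα0.trans hy.1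
  have hζ1 : ζ ≤ 1 := by rw [hζ, div_le_one hβ0]; linarith [hy.2]
  have hwζ : (α : ℝ) + β * ζ = y := by rw [hζ]; field_simp; ring
  have hwpos : ∀ x ∈ Icc ζ 1, 0 < (α : ℝ) + β * x := fun x hx => by
    have h1 : (β : ℝ) * ζ ≤ β * x := mul_le_mul_of_nonneg_left hx.1 hβ0.le
    linarith
  -- the primitive `(rational part) + Res(y) log w` of `Ψ(y,·)` on `[ζ, 1]`
  have hderiv : ∀ x ∈ uIcc ζ 1, HasDerivAt (fun s : ℝ =>
      (∑ m ∈ P.support, ∑ k ∈ (Finset.range (m 1 + 1)).erase (m 0),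
        ((P.coeff m : ℚ) : ℝ) * y ^ (m 0) *
          ((((m 1).choose k : ℝ) * (-(α : ℝ)) ^ (m 1 - k) / (β : ℝ) ^ (m 1 + 1)) /
            ((k : ℝ) - m 0)) * ((α : ℝ) + β * s) ^ ((k : ℤ) - m 0)) +
      (∑ m ∈ P.support, ((P.coeff m : ℚ) : ℝ) *
        (((m 1).choose (m 0) : ℝ) * (-(α : ℝ)) ^ (m 1 - m 0) / (β : ℝ) ^ (m 1 + 1)) *
          y ^ (m 0)) * Real.log ((α : ℝ) + β * s))
      (∑ m ∈ P.support, ((P.coeff m : ℚ) : ℝ) *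
          (y ^ (m 0) * x ^ (m 1) / ((α : ℝ) + β * x) ^ (m 0 + 1))) x := by
    intro x hx
    rw [uIcc_of_le hζ1] at hx
    have h1 := hasDerivAt_primSum α β hβ.ne' P y x (hwpos x hx).ne'
    have hlin : HasDerivAt (fun s' : ℝ => (α : ℝ) + β * s') (β : ℝ) x := by
      simpa using ((hasDerivAt_id x).const_mul (β : ℝ)).const_add (α : ℝ)
    have h2 := ((Real.hasDerivAt_log (hwpos x hx).ne').comp x hlin).const_mul
      (∑ m ∈ P.support, ((P.coeff m : ℚ) : ℝ) *
        (((m 1).choose (m 0) : ℝ) * (-(α : ℝ)) ^ (m 1 - m 0) / (β : ℝ) ^ (m 1 + 1)) *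
          y ^ (m 0))
    refine (h1.fun_add h2).congr_deriv ?_
    ring
  have hcont : ContinuousOn (fun x : ℝ => ∑ m ∈ P.support, ((P.coeff m : ℚ) : ℝ) *
      (y ^ (m 0) * x ^ (m 1) / ((α : ℝ) + β * x) ^ (m 0 + 1))) (uIcc ζ 1) := by
    rw [uIcc_of_le hζ1]
    refine continuousOn_finsetSum _ fun m _ => continuousOn_const.mul ?_
    exact ContinuousOn.div₀ (by fun_prop) (by fun_prop) fun x hx => pow_ne_zero _ (hwpos x hx).ne'
  -- fundamental theorem of calculus for `hΦ y`
  have hΦy := hΦ y hy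
  rw [setIntegral_congr_fun measurableSet_Ioo (fun x hx =>
      aeval_div_eq_sum α β P y x (hwpos x ⟨hx.1.le, hx.2.le⟩).ne'),
    ← integral_Ioc_eq_integral_Ioo, ← intervalIntegral.integral_of_le hζ1,
    intervalIntegral.integral_eq_sub_of_hasDerivAt hderiv hcont.intervalIntegrable, hwζ,
    mul_one] at hΦy
  rw [hwζ]
  linarith

/-- **All residues vanish**: `Res(y) = Σ_{(a,j)} P_{a,j} λ_{j,a} y^a = 0` for every real `y`:
by `res_mul_log_eq`, `Res(u) log u = f(u)` on `(α, α+β)` for an explicit real polynomial `f` (at the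
fibre `w((u−α)/β) = u`, so `u^a · w^{k−a}` is the monomial `u^k`), and `eq_zero_of_mul_log_eq`
applies. [folklore] -/
theorem residue_eq_zero (α β : ℚ) (P : MvPolynomial (Fin 2) ℚ) (hα : 0 < α) (hβ : 0 < β)
    (hΦ : ∀ y ∈ Ioo (α : ℝ) (α + β), ∫ s in Ioo ((y - α) / β) 1,
      aeval ![y / ((α : ℝ) + β * s), s] P / ((α : ℝ) + β * s) = 0) (y : ℝ) :
    ∑ m ∈ P.support, ((P.coeff m : ℚ) : ℝ) *
        (((m 1).choose (m 0) : ℝ) * (-(α : ℝ)) ^ (m 1 - m 0) / (β : ℝ) ^ (m 1 + 1)) *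
          y ^ (m 0) = 0 := by
  classical
  have hα0 : (0 : ℝ) < α := by exact_mod_cast hα
  have hβ0 : (0 : ℝ) < β := by exact_mod_cast hβ
  have hαβ : (α : ℝ) < α + β := by linarith
  set g : Polynomial ℝ := ∑ m ∈ P.support, Polynomial.C (((P.coeff m : ℚ) : ℝ) *
      (((m 1).choose (m 0) : ℝ) * (-(α : ℝ)) ^ (m 1 - m 0) / (β : ℝ) ^ (m 1 + 1))) *
        Polynomial.X ^ (m 0) with hg
  set f : Polynomial ℝ := ∑ m ∈ P.support, Polynomial.C ((P.coeff m : ℚ) : ℝ) *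
      (Polynomial.C ((∑ k ∈ (Finset.range (m 1 + 1)).erase (m 0),
          ((((m 1).choose k : ℝ) * (-(α : ℝ)) ^ (m 1 - k) / (β : ℝ) ^ (m 1 + 1)) /
            ((k : ℝ) - m 0)) * ((α : ℝ) + β) ^ ((k : ℤ) - m 0)) +
          (((m 1).choose (m 0) : ℝ) * (-(α : ℝ)) ^ (m 1 - m 0) / (β : ℝ) ^ (m 1 + 1)) *
            Real.log ((α : ℝ) + β)) * Polynomial.X ^ (m 0) -
        ∑ k ∈ (Finset.range (m 1 + 1)).erase (m 0),
          Polynomial.C ((((m 1).choose k : ℝ) * (-(α : ℝ)) ^ (m 1 - k) / (β : ℝ) ^ (m 1 + 1)) /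
            ((k : ℝ) - m 0)) * Polynomial.X ^ k) with hf
  have hgeval : ∀ u : ℝ, g.eval u = ∑ m ∈ P.support, ((P.coeff m : ℚ) : ℝ) *
      (((m 1).choose (m 0) : ℝ) * (-(α : ℝ)) ^ (m 1 - m 0) / (β : ℝ) ^ (m 1 + 1)) *
        u ^ (m 0) := by
    intro u
    simp only [hg, Polynomial.eval_finsetSum, Polynomial.eval_mul, Polynomial.eval_C,
      Polynomial.eval_pow, Polynomial.eval_X]
  have hid : ∀ u ∈ Ioo (α : ℝ) (α + β), g.eval u * Real.log u = f.eval u := by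
    intro u hu
    have hu0 : u ≠ 0 := (hα0.trans hu.1).ne'
    rw [hgeval, res_mul_log_eq α β P hα hβ hΦ u hu]
    have hwζ : (α : ℝ) + β * ((u - α) / β) = u := by field_simp; ring
    rw [hwζ]
    simp only [hf, Polynomial.eval_finsetSum, Polynomial.eval_mul, Polynomial.eval_C,
      Polynomial.eval_pow, Polynomial.eval_X, Polynomial.eval_sub]
    rw [Finset.sum_mul, ← Finset.sum_sub_distrib, ← Finset.sum_add_distrib]
    refine Finset.sum_congr rfl fun m _ => ?_
    have h0 : ∑ k ∈ (Finset.range (m 1 + 1)).erase (m 0),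
        ((P.coeff m : ℚ) : ℝ) * u ^ (m 0) *
          ((((m 1).choose k : ℝ) * (-(α : ℝ)) ^ (m 1 - k) / (β : ℝ) ^ (m 1 + 1)) /
            ((k : ℝ) - m 0)) * ((α : ℝ) + β) ^ ((k : ℤ) - m 0) =
        ((P.coeff m : ℚ) : ℝ) * u ^ (m 0) * ∑ k ∈ (Finset.range (m 1 + 1)).erase (m 0),
          ((((m 1).choose k : ℝ) * (-(α : ℝ)) ^ (m 1 - k) / (β : ℝ) ^ (m 1 + 1)) /
            ((k : ℝ) - m 0)) * ((α : ℝ) + β) ^ ((k : ℤ) - m 0) := by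
      rw [Finset.mul_sum]
      exact Finset.sum_congr rfl fun k _ => by ring
    have h1 : ∑ k ∈ (Finset.range (m 1 + 1)).erase (m 0),
        ((P.coeff m : ℚ) : ℝ) * u ^ (m 0) *
          ((((m 1).choose k : ℝ) * (-(α : ℝ)) ^ (m 1 - k) / (β : ℝ) ^ (m 1 + 1)) /
            ((k : ℝ) - m 0)) * u ^ ((k : ℤ) - m 0) =
        ((P.coeff m : ℚ) : ℝ) * ∑ k ∈ (Finset.range (m 1 + 1)).erase (m 0),
          ((((m 1).choose k : ℝ) * (-(α : ℝ)) ^ (m 1 - k) / (β : ℝ) ^ (m 1 + 1)) /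
            ((k : ℝ) - m 0)) * u ^ k := by
      rw [Finset.mul_sum]
      refine Finset.sum_congr rfl fun k _ => ?_
      rw [zpow_sub₀ hu0, zpow_natCast, zpow_natCast]
      field_simp
    rw [h0, h1]
    ring
  have hg0 : g = 0 := eq_zero_of_mul_log_eq hα0 hαβ g.support.card f g le_rfl hid
  have h := hgeval y
  rw [hg0, Polynomial.eval_zero] at h
  exact h.symm

end LinResidues

open LinResidues in
/-- STUB `stub_linResidues` (linear class, step 3: LOG-ELIMINATION / RESIDUES). For `P ∈ ℚ[z₁,z₂]`,
`0 < α`, `0 < β`, `w(s) = α + βs`, `Ψ(y,s) = P(y/w(s), s)/w(s)`: if `∫_{(y−α)/β}^1 Ψ(y,s) ds = 0`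
for all `y ∈ (α, α+β)`, then there are `k` and `M ∈ ℚ[y,s]` with `d/ds [M(y,s)/w(s)^k] = Ψ(y,s)` for
every real `y` and every `s` with `w(s) ≠ 0`. The residues `Res(y) = Σ P_{a,j} λ_{j,a} y^a` of the
monomials at the pole `w = 0` satisfy `Res(y) log y = (polynomial)(y)` on `(α, α+β)` (fundamental
theorem of calculus, `LinResidues.res_mul_log_eq`), hence vanish (`log` is not rational on an
interval, `LinResidues.eq_zero_of_mul_log_eq`), and the non-residual parts have the explicit
rational primitive `M/w^k`, `k = max a` (`LinResidues.hasDerivAt_primSum`).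
[cite: KontsevichZagier2001, §1.2] -/
theorem stub_linResidues (α β : ℚ) (P : MvPolynomial (Fin 2) ℚ) (hα : 0 < α) (hβ : 0 < β)
    (hΦ : ∀ y ∈ Ioo (α : ℝ) (α + β), ∫ s in Ioo ((y - α) / β) 1,
      aeval ![y / ((α : ℝ) + β * s), s] P / ((α : ℝ) + β * s) = 0) :
    ∃ (k : ℕ) (M : MvPolynomial (Fin 2) ℚ), ∀ (y s : ℝ), (α : ℝ) + β * s ≠ 0 →
      HasDerivAt (fun s' : ℝ => aeval ![y, s'] M / ((α : ℝ) + β * s') ^ k)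
        (aeval ![y / ((α : ℝ) + β * s), s] P / ((α : ℝ) + β * s)) s := by
  classical
  set K : ℕ := P.support.sup (fun m => m 0) with hK
  set M : MvPolynomial (Fin 2) ℚ := ∑ m ∈ P.support, ∑ k ∈ (Finset.range (m 1 + 1)).erase (m 0),
    C (P.coeff m * ((((m 1).choose k : ℚ) * (-α) ^ (m 1 - k) / β ^ (m 1 + 1)) /
      ((k : ℚ) - m 0))) * X 0 ^ (m 0) * (C α + C β * X 1) ^ (K - m 0 + k) with hM
  refine ⟨K, M, fun y s hw => ?_⟩
  have hK' : ∀ m ∈ P.support, m 0 ≤ K := fun m hm => Finset.le_sup (f := fun m => m 0) hm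
  -- `M(y,s')/w(s')^K` is the explicit rational primitive of `LinResidues.hasDerivAt_primSum`
  have heval : ∀ s' : ℝ, (α : ℝ) + β * s' ≠ 0 →
      aeval ![y, s'] M / ((α : ℝ) + β * s') ^ K =
        ∑ m ∈ P.support, ∑ k ∈ (Finset.range (m 1 + 1)).erase (m 0),
          ((P.coeff m : ℚ) : ℝ) * y ^ (m 0) *
            ((((m 1).choose k : ℝ) * (-(α : ℝ)) ^ (m 1 - k) / (β : ℝ) ^ (m 1 + 1)) /
              ((k : ℝ) - m 0)) * ((α : ℝ) + β * s') ^ ((k : ℤ) - m 0) := by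
    intro s' hw'
    simp only [hM, map_sum, map_mul, map_pow, map_add, MvPolynomial.aeval_C,
      MvPolynomial.aeval_X, Matrix.cons_val_zero, Matrix.cons_val_one, eq_ratCast, Finset.sum_div]
    refine Finset.sum_congr rfl fun m hm => Finset.sum_congr rfl fun k _ => ?_
    have hexp : (((K - m 0 + k : ℕ) : ℤ)) = ((k : ℤ) - m 0) + K := by
      push_cast [Nat.cast_sub (hK' m hm)]
      ring
    have hpow : ((α : ℝ) + β * s') ^ (K - m 0 + k) =
        ((α : ℝ) + β * s') ^ ((k : ℤ) - m 0) * ((α : ℝ) + β * s') ^ K := by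
      rw [← zpow_natCast _ (K - m 0 + k), hexp, zpow_add₀ hw', zpow_natCast]
    rw [div_eq_iff (pow_ne_zero K hw'), hpow]
    push_cast
    ring
  -- the residues vanish, so the primitive of `hasDerivAt_primSum` is a primitive of `Ψ(y,·)`
  have hprim := hasDerivAt_primSum α β hβ.ne' P y s hw
  rw [residue_eq_zero α β P hα hβ hΦ y, mul_zero, zero_mul, sub_zero,
    ← aeval_div_eq_sum α β P y s hw] at hprim
  have hev : ∀ᶠ s' in 𝓝 s, (α : ℝ) + β * s' ≠ 0 :=
    (continuous_const.add (continuous_const.mul continuous_id)).continuousAt.eventually_ne hw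
  exact hprim.congr_of_eventuallyEq (hev.mono fun s' hs' => heval s' hs')

end Summit.KontsevichZagierPeriods.InverseLandau.TateFamilyKernel.Descent
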